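import Literature.AlgebraicGeometry.Resolution.NeronPopescuDesingularizationLemma
import Literature.AlgebraicGeometry.Resolution.StrictlyStandardBaseChange
import HarnessLib

/-!
# Desingularization over an auxiliary algebra (Stacks 07CT)

Topic: `Literature/AlgebraicGeometry/Resolution`. The Stacks Project, *Smoothing Ring Maps*
(Tag 07BW), Lemma 07CT (= Lemma 16.7.2):

> **Lemma 07CT.** Let `R` be a Noetherian ring. Let `Λ` be an `R`-algebra. Let `π ∈ R` and assume
> that `Ann_R(π) = Ann_R(π²)` and `Ann_Λ(π) = Ann_Λ(π²)`. Let `A → Λ` and `D → Λ` be `R`-algebra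
> maps with `A` and `D` of finite presentation. Assume (1) `π` is strictly standard in `A` over
> `R`, and (2) there exists an `R`-algebra map `A/π⁴A → D/π⁴D` compatible with the maps to
> `Λ/π⁴Λ`. Then we can find an `R`-algebra map `B → Λ` with `B` of finite presentation and
> `R`-algebra maps `A → B` and `D → B` compatible with the maps to `Λ` such that
> `H_{D/R}B ⊂ H_{B/D}` and `H_{D/R}B ⊂ H_{B/R}`.

Proof as printed: "We apply Lemma 07CR to `D → A ⊗_R D → Λ` and the image of `π` in `D`. By
Lemma 07CC we see that `π` is strictly standard in `A ⊗_R D` over `D`. As our section `ρ` … we take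
the map induced by the map in (2). Thus Lemma 07CR applies … `𝔞B ⊂ H_{B/D}` … For any prime `𝔮` of
`D` such that `D_𝔮` is flat over `R` we have `Ann_{D_𝔮}(π²)/Ann_{D_𝔮}(π) = 0` … Thus we see that
`𝔞 ⊄ 𝔮`. Hence … `D → B` is smooth at any prime of `B` lying over `𝔮` … we conclude that
`H_{D/R}B ⊂ H_{B/D}`. The final inclusion `H_{D/R}B ⊂ H_{B/R}` follows because compositions of
smooth ring maps are smooth." Rendering: `Stacks07CR_desingularization`
(`NeronPopescuDesingularizationLemma.lean`), `IsStrictlyStandard.baseChange`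
(`StrictlyStandardBaseChange.lean`), the flat-annihilator statement `exists_notMem_mul_ann` (via
`Stacks07CR.pi_mul_eq_zero_of_sq` in the local ring of the smooth algebra `D_x` at `𝔮`), and
for the last inclusion `FormallySmooth R D_x`, `FormallySmooth D_x B_𝔓` (Mathlib
`FormallySmooth.localization_base`) and `FormallySmooth.comp`; singular ideals are Stacks 07C5
(`singularIdeal`, `mem_singularIdeal_iff`). The compatibility in (2) is rendered as: if the map
sends `ā` to `d̄` then `φ(a) ≡ ψ(d) mod π⁴Λ`.

## References

* The Stacks Project, *Smoothing Ring Maps* (Tag 07BW), Lemma 07CT and its proof; Lemmas 07CR,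
  07CC, 07C5. [StacksProject]
-/

noncomputable section

open MvPolynomial TensorProduct

namespace Literature.AlgebraicGeometry.Resolution

universe u

/-! ## Stacks 07CT: desingularization over an auxiliary algebra `D` -/

namespace Stacks07CT

variable {R : Type u} [CommRing R] {D : Type u} [CommRing D] [Algebra R D] (π : R)

/-- **Annihilators under flat localization** (Stacks 07CT: "For any prime `𝔮` of `D` such that
`D_𝔮` is flat over `R` we have `Ann_{D_𝔮}(π²)/Ann_{D_𝔮}(π) = 0` because annihilators of elements
commutes with flat base change and we assumed `Ann_R(π) = Ann_R(π²)`. Because `D` is Noetherian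
… formation of its annihilator commutes with localization. Thus we see that `𝔞 ⊄ 𝔮`"): if
`Ann_R(π) = Ann_R(π²)`, `D_x` is smooth over `R` and `x ∉ 𝔮`, then some `s ∉ 𝔮` satisfies
`s · Ann_D(π²) ⊆ Ann_D(π)`. [cite: StacksProject, Tag 07CT] -/
theorem exists_notMem_mul_ann [IsNoetherianRing D] (hR : ∀ s : R, π ^ 2 * s = 0 → π * s = 0)
    (x : D) [Algebra.Smooth R (Localization.Away x)] (𝔮 : Ideal D) [𝔮.IsPrime] (hx : x ∉ 𝔮) :
    ∃ s ∉ 𝔮, ∀ y : D, algebraMap R D π ^ 2 * y = 0 → algebraMap R D π * (s * y) = 0 := by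
  classical
  let Dx := Localization.Away x
  haveI : IsNoetherianRing Dx := IsLocalization.isNoetherianRing (Submonoid.powers x) Dx inferInstance
  have hdisj : Disjoint (Submonoid.powers x : Set D) (𝔮 : Set D) := by
    rw [Set.disjoint_left]
    rintro _ ⟨k, rfl⟩ hk
    exact hx (‹𝔮.IsPrime›.mem_of_pow_mem k hk)
  let 𝔮ₓ : Ideal Dx := 𝔮.map (algebraMap D Dx)
  haveI : 𝔮ₓ.IsPrime := IsLocalization.isPrime_of_isPrime_disjoint (Submonoid.powers x) Dx 𝔮 ‹_› hdisj
  have hcomap : 𝔮ₓ.comap (algebraMap D Dx) = 𝔮 :=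
    IsLocalization.under_map_of_isPrime_disjoint (Submonoid.powers x) Dx ‹𝔮.IsPrime› hdisj
  let L := Localization.AtPrime 𝔮ₓ
  haveI : Module.Flat Dx L := IsLocalization.flat L 𝔮ₓ.primeCompl
  haveI : Module.Flat R L := Module.Flat.trans R Dx L
  let I₀ : Ideal D := 𝔮ₓ.comap (algebraMap D Dx)
  haveI : I₀.IsPrime := by rw [show I₀ = 𝔮 from hcomap]; infer_instance
  haveI : IsLocalization.AtPrime L I₀ := inferInstance
  -- in `L`, `Ann(π²) = Ann(π)`
  have hL : ∀ z : L, algebraMap R L π ^ 2 * z = 0 → algebraMap R L π * z = 0 := fun z hz =>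
    Stacks07CR.pi_mul_eq_zero_of_sq π (r₀ := 1) (fun s hs => by rw [one_mul]; exact hR s hs)
      (by rw [map_one]; exact isUnit_one) z hz
  -- each `y ∈ Ann_D(π²)` is killed by `π s_y` for some `s_y ∉ 𝔮`
  have hy : ∀ y : D, algebraMap R D π ^ 2 * y = 0 →
      ∃ s ∉ 𝔮, algebraMap R D π * (s * y) = 0 := by
    intro y hy
    have h1 : algebraMap R L π * algebraMap D L y = 0 := by
      apply hL
      rw [IsScalarTower.algebraMap_apply R D L, ← map_pow, ← map_mul, hy, map_zero]
    rw [IsScalarTower.algebraMap_apply R D L, ← map_mul] at h1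
    obtain ⟨⟨s, hs⟩, hs0⟩ := (IsLocalization.map_eq_zero_iff I₀.primeCompl L _).mp h1
    refine ⟨s, ?_, by rw [← hs0]; ring⟩
    change s ∉ I₀ at hs
    rwa [show I₀ = 𝔮 from hcomap] at hs
  -- finitely many generators of `Ann_D(π²)`
  let K : Ideal D := LinearMap.ker (LinearMap.mul D D (algebraMap R D π ^ 2))
  obtain ⟨S, hS⟩ := (IsNoetherian.noetherian K : K.FG)
  have hmemK : ∀ y ∈ S, algebraMap R D π ^ 2 * y = 0 := fun y hyS => by
    have : y ∈ K := hS ▸ Submodule.subset_span hyS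
    simpa [K, LinearMap.mul_apply'] using this
  choose! sy hsy hsy0 using hy
  refine ⟨∏ y ∈ S, sy y, ?_, fun y hy0 => ?_⟩
  · have : (∏ y ∈ S, sy y) ∈ 𝔮.primeCompl :=
      prod_mem fun y hyS => show sy y ∈ 𝔮.primeCompl from hsy y (hmemK y hyS)
    exact this
  · have hyK : y ∈ Submodule.span D (S : Set D) := by
      rw [hS]; simpa [K, LinearMap.mul_apply'] using hy0
    clear hy0
    induction hyK using Submodule.span_induction with
    | mem z hz =>
      rw [← Finset.mul_prod_erase S sy hz, show algebraMap R D π * (sy z * (∏ w ∈ S.erase z, sy w) * z)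
        = (∏ w ∈ S.erase z, sy w) * (algebraMap R D π * (sy z * z)) by ring, hsy0 z (hmemK z hz),
        mul_zero]
    | zero => simp
    | add a b _ _ ha hb => rw [mul_add, mul_add, ha, hb, add_zero]
    | smul d a _ ha =>
      rw [smul_eq_mul, show algebraMap R D π * ((∏ y ∈ S, sy y) * (d * a)) =
        d * (algebraMap R D π * ((∏ y ∈ S, sy y) * a)) by ring, ha, mul_zero]

/-- In `D ⊗_R A`, `1 ⊗ π_A` is the image of `π_D`. [folklore] -/
theorem one_tmul_algebraMap {A : Type u} [CommRing A] [Algebra R A] (π : R) :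
    ((1 : D) ⊗ₜ[R] algebraMap R A π : D ⊗[R] A) = algebraMap D (D ⊗[R] A) (algebraMap R D π) := by
  rw [Algebra.algebraMap_eq_smul_one π, Algebra.algebraMap_eq_smul_one (algebraMap R D π),
    algebraMap_smul, TensorProduct.tmul_smul, Algebra.TensorProduct.one_def]

end Stacks07CT

open Stacks07CT in
/-- **Stacks, Lemma 07CT.** Let `R` be a Noetherian ring, `Λ` an `R`-algebra, `π ∈ R` with
`Ann_R(π) = Ann_R(π²)` and `Ann_Λ(π) = Ann_Λ(π²)`. Let `A → Λ` and `D → Λ` be `R`-algebra maps with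
`A` and `D` of finite presentation. Assume (1) `π` is strictly standard in `A` over `R`, and (2)
there exists an `R`-algebra map `A/π⁴A → D/π⁴D` compatible with the maps to `Λ/π⁴Λ`. Then we can
find an `R`-algebra map `B → Λ` with `B` of finite presentation and `R`-algebra maps `A → B` and
`D → B` compatible with the maps to `Λ` such that `H_{D/R}B ⊂ H_{B/D}` and `H_{D/R}B ⊂ H_{B/R}`.
(Here `B` is returned with its `D`-algebra structure, `D → B` being `algebraMap`, and the two
inclusions elementwise for `x ∈ H_{D/R} = singularIdeal R D`.) Proof as printed: Lemma 07CR
(`Stacks07CR_desingularization`) applied to `D → A ⊗_R D → Λ` and the image of `π` in `D`, which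
is strictly standard by Lemma 07CC (`IsStrictlyStandard.baseChange`); then `𝔞 ⊄ 𝔮` at primes
where `D` is flat over `R` (`exists_notMem_mul_ann`) and "compositions of smooth ring maps are
smooth". [cite: StacksProject, Tag 07CT] -/
theorem Stacks07CT_desingularizeStrictlyStandard {R : Type u} [CommRing R] [IsNoetherianRing R]
    {Λ : Type u} [CommRing Λ] [Algebra R Λ] (π : R)
    (hR : ∀ s : R, π ^ 2 * s = 0 → π * s = 0)
    (hΛ : ∀ x : Λ, algebraMap R Λ π ^ 2 * x = 0 → algebraMap R Λ π * x = 0)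
    {A : Type u} [CommRing A] [Algebra R A] [Algebra.FinitePresentation R A] (φ : A →ₐ[R] Λ)
    {D : Type u} [CommRing D] [Algebra R D] [Algebra.FinitePresentation R D] (ψ : D →ₐ[R] Λ)
    (hπ : IsStrictlyStandard R (algebraMap R A π))
    (χ : (A ⧸ Ideal.span {algebraMap R A π ^ 4}) →ₐ[R] D ⧸ Ideal.span {algebraMap R D π ^ 4})
    (hχ : ∀ (a : A) (d : D), χ (Ideal.Quotient.mk _ a) = Ideal.Quotient.mk _ d →
      φ a - ψ d ∈ Ideal.span {algebraMap R Λ π ^ 4}) :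
    ∃ (B : Type u) (_ : CommRing B) (_ : Algebra R B) (_ : Algebra D B) (_ : IsScalarTower R D B)
      (fA : A →ₐ[R] B) (g : B →ₐ[R] Λ),
      Algebra.FinitePresentation R B ∧ (∀ a, g (fA a) = φ a) ∧
      (∀ d, g (algebraMap D B d) = ψ d) ∧
      ∀ x ∈ singularIdeal R D,
        algebraMap D B x ∈ singularIdeal D B ∧ algebraMap D B x ∈ singularIdeal R B := by
  classical
  letI : Algebra D Λ := ψ.toRingHom.toAlgebra
  haveI : IsScalarTower R D Λ := IsScalarTower.of_algebraMap_eq fun x => (ψ.commutes x).symm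
  haveI : IsNoetherianRing D := Algebra.FiniteType.isNoetherianRing R D
  let πD : D := algebraMap R D π
  have hψ : ∀ d, algebraMap D Λ d = ψ d := fun d => rfl
  have hπD : algebraMap D Λ πD = algebraMap R Λ π := (IsScalarTower.algebraMap_apply R D Λ π).symm
  have hΛ' : ∀ x : Λ, algebraMap D Λ πD ^ 2 * x = 0 → algebraMap D Λ πD * x = 0 := by
    rw [hπD]; exact hΛ
  -- `A' = D ⊗ A`
  let A' := D ⊗[R] A
  let φ' : A' →ₐ[D] Λ := Algebra.TensorProduct.lift (Algebra.ofId D Λ) φ fun _ _ => Commute.all _ _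
  have hφ' : ∀ (d : D) (a : A), φ' (d ⊗ₜ a) = ψ d * φ a := fun d a =>
    Algebra.TensorProduct.lift_tmul _ _ _ d a
  have hπ' : IsStrictlyStandard D (algebraMap D A' πD) := by
    have := IsStrictlyStandard.baseChange D hπ
    rwa [one_tmul_algebraMap] at this
  -- the section `ρ' : A'/π⁴ → D/π⁴`
  let ρ₀ : A' →ₐ[D] D ⧸ Ideal.span {πD ^ 4} :=
    Algebra.TensorProduct.lift (Ideal.Quotient.mkₐ D _) (χ.comp (Ideal.Quotient.mkₐ R _))
      fun _ _ => Commute.all _ _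
  have hρ₀ : ∀ (d : D) (a : A), ρ₀ (d ⊗ₜ a) = Ideal.Quotient.mk _ d * χ (Ideal.Quotient.mk _ a) :=
    fun d a => Algebra.TensorProduct.lift_tmul _ _ _ d a
  let ρ' : (A' ⧸ Ideal.span {algebraMap D A' πD ^ 4}) →ₐ[D] D ⧸ Ideal.span {πD ^ 4} :=
    Ideal.Quotient.liftₐ _ ρ₀ fun a ha => by
      rw [← RingHom.mem_ker]
      refine (Ideal.span_le.mpr ?_) ha
      rw [Set.singleton_subset_iff, SetLike.mem_coe, RingHom.mem_ker]
      change ρ₀ (algebraMap D A' πD ^ 4) = 0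
      rw [map_pow, AlgHom.commutes, Ideal.Quotient.algebraMap_eq,
        ← map_pow (Ideal.Quotient.mk (Ideal.span {πD ^ 4})), Ideal.Quotient.eq_zero_iff_mem]
      exact Ideal.mem_span_singleton_self _
  -- compatibility with `Λ/π⁴Λ`
  let IΛ : Ideal Λ := Ideal.span {algebraMap D Λ πD ^ 4}
  have hq : Ideal.span {πD ^ 4} ≤ IΛ.comap (algebraMap D Λ) := by
    rw [Ideal.span_le, Set.singleton_subset_iff, SetLike.mem_coe, Ideal.mem_comap, map_pow]
    exact Ideal.mem_span_singleton_self _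
  let q : (D ⧸ Ideal.span {πD ^ 4}) →ₐ[D] Λ ⧸ IΛ := Ideal.quotientMapₐ IΛ (Algebra.ofId D Λ) hq
  have hqmk : ∀ d, q (Ideal.Quotient.mk _ d) = Ideal.Quotient.mk _ (algebraMap D Λ d) := fun d => rfl
  have hχq : ∀ a : A, q (χ (Ideal.Quotient.mk _ a)) = Ideal.Quotient.mk IΛ (φ a) := by
    intro a
    obtain ⟨d, hd⟩ := Ideal.Quotient.mk_surjective (χ (Ideal.Quotient.mk _ a))
    rw [← hd, hqmk, Ideal.Quotient.eq, hψ]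
    have := hχ a d hd.symm
    change _ ∈ Ideal.span {algebraMap D Λ πD ^ 4}
    rw [hπD, ← Ideal.neg_mem_iff, neg_sub]
    exact this
  have hfun : ∀ a' : A', Ideal.Quotient.mk IΛ (φ' a') = q (ρ₀ a') := by
    intro a'
    induction a' using TensorProduct.induction_on with
    | zero => simp only [map_zero]
    | tmul d a => rw [hφ', hρ₀, map_mul, map_mul, hχq, hqmk, hψ]
    | add x y hx hy => rw [map_add, map_add, map_add, map_add, hx, hy]
  have hρ' : ∀ (a' : A') (d : D), ρ' (Ideal.Quotient.mk _ a') = Ideal.Quotient.mk _ d →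
      φ' a' - algebraMap D Λ d ∈ Ideal.span {algebraMap D Λ πD ^ 4} := by
    intro a' d h
    change ρ₀ a' = _ at h
    rw [← Ideal.Quotient.eq, hfun, h, hqmk]
  -- apply Lemma 07CR over the base `D`
  obtain ⟨B, _, _, f, g, hfp, hgf, hsing⟩ :=
    Stacks07CR_desingularization (R := D) πD hΛ' φ' hπ' ρ' hρ'
  letI : Algebra R B := ((algebraMap D B).comp (algebraMap R D)).toAlgebra
  haveI : IsScalarTower R D B := IsScalarTower.of_algebraMap_eq fun x => rfl
  haveI : Algebra.FinitePresentation R B := Algebra.FinitePresentation.trans R D B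
  let fA : A →ₐ[R] B := (f.restrictScalars R).comp Algebra.TensorProduct.includeRight
  refine ⟨B, inferInstance, inferInstance, inferInstance, inferInstance, fA, g.restrictScalars R,
    inferInstance, fun a => ?_, fun d => ?_, fun x hx => ?_⟩
  · change g (f ((1 : D) ⊗ₜ a)) = φ a
    rw [hgf, hφ', map_one, one_mul]
  · change g (algebraMap D B d) = ψ d
    rw [AlgHom.commutes, hψ]
  -- the two inclusions
  haveI : Algebra.Smooth R (Localization.Away x) := mem_singularIdeal_iff_smooth.mp hx
  have hD : algebraMap D B x ∈ singularIdeal D B := by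
    rw [mem_singularIdeal_iff]
    intro 𝔓 hx𝔓
    let 𝔮 : Ideal D := 𝔓.asIdeal.comap (algebraMap D B)
    haveI : 𝔮.IsPrime := Ideal.IsPrime.comap _
    obtain ⟨s, hs, hs𝔞⟩ := exists_notMem_mul_ann π hR x 𝔮 hx𝔓
    exact mem_singularIdeal_iff.mp (hsing s hs𝔞) 𝔓 hs
  refine ⟨hD, ?_⟩
  rw [mem_singularIdeal_iff]
  intro 𝔓 hx𝔓
  have h1 : Algebra.IsSmoothAt D 𝔓.asIdeal := mem_singularIdeal_iff.mp hD 𝔓 hx𝔓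
  -- `B_𝔓` is an algebra over `D_x`
  let Dx := Localization.Away x
  let B𝔓 := Localization.AtPrime 𝔓.asIdeal
  have hxu : IsUnit (algebraMap D B𝔓 x) := by
    rw [IsScalarTower.algebraMap_apply D B B𝔓]
    exact (IsLocalization.AtPrime.isUnit_to_map_iff B𝔓 𝔓.asIdeal _).mpr hx𝔓
  letI : Algebra Dx B𝔓 := (IsLocalization.Away.lift x hxu).toAlgebra
  haveI : IsScalarTower D Dx B𝔓 := IsScalarTower.of_algebraMap_eq fun d =>
    (IsLocalization.Away.lift_eq x hxu d).symm
  haveI : IsScalarTower R Dx B𝔓 := IsScalarTower.of_algebraMap_eq fun y => by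
    rw [IsScalarTower.algebraMap_apply R D B𝔓, IsScalarTower.algebraMap_apply R D Dx,
      ← IsScalarTower.algebraMap_apply D Dx B𝔓]
  haveI : Algebra.FormallySmooth D B𝔓 := h1
  haveI : Algebra.FormallySmooth Dx B𝔓 :=
    Algebra.FormallySmooth.localization_base (M := Submonoid.powers x) (R := D)
  haveI : Algebra.FormallySmooth R Dx := Algebra.Smooth.formallySmooth
  exact Algebra.FormallySmooth.comp R Dx B𝔓

end Literature.AlgebraicGeometry.Resolution

end
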